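import Mathlib.Analysis.Calculus.ContDiff.Basic
import Mathlib.Analysis.Calculus.IteratedDeriv.Lemmas
import Mathlib.Logic.Function.DependsOn
import Literature.MathematicalPhysics.KineticTheory.InfiniteChainObservables

/-!
# Discrete variational calculus on the infinite oscillator chain: vocabulary

Topic `Literature/MathematicalPhysics/KineticTheory` (namespace
`Literature.MathematicalPhysics.KineticTheory.HeatConduction`, the vocabulary of the infinite chain
`ChainConfig = ℤ → ℝ × ℝ` of `InfiniteChainDynamics` / `InfiniteChainInvariantStates` /
`InfiniteChainObservables`). Wanted by the support item `NoLocalIntegrals` of route `LocalOhmBV` of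
`AtomisticToContinuum/FouriersLaw` (classification of the local conservation laws of the pinned
anharmonic chain by the symmetry approach), whose helper files prove the calculus; this module only
FIXES THE VOCABULARY (definitions + unfolding lemmas + the elementary derivative computations for
`pinnedChain`):

* `IsSmoothLocal f` — a smooth local observable, `f = g ∘ boxRestrict R` with `g ∈ C^∞` on the box
  `(ℝ × ℝ)^{2R+1}` (Bernardin's local `C^∞` functions WITHOUT the boundedness of `C₀ᵏ`; the densities and
  fluxes of local conservation laws are of this kind — e.g. the site energy is unbounded);
* `shiftPow k` — the iterated lattice shift `(τᵏσ)_x = σ_{x+k}`, `k ∈ ℤ` (`shiftPow 1 = shift`), and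
  `reflectZ`, the lattice reflection `(ρσ)_x = σ_{-x}`;
* `varDerivQ S f`, `varDerivP S f` — the (formal) VARIATIONAL DERIVATIVES of a local density `f` with
  respect to positions and momenta, `E_q f = ∑_{n∈S} (∂_{q_n} f) ∘ τ⁻ⁿ`, `E_p f = ∑_{n∈S} (∂_{p_n} f) ∘ τ⁻ⁿ`
  over a finite index window `S` (any window containing the support of `f` gives the same function) —
  Yamilov's `δ/δu_n = ∑_i T^{-i} ∂/∂u_{n+i}` for the two dependent variables `(q, p)` of the chain;
* `OscillatorChain.stiff P σ n = V''(q_{n+1} - q_n)` — the bond stiffness, `OscillatorChain.stiffProd P M σ =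
  ∏_{i<M} V''(q_{i+1} - q_i)`, and the LINEARISED FORCE (Jacobi) operator of the chain on a lattice
  variation `η`, `OscillatorChain.linForceOp P η = V''(r₋₁)·η∘τ⁻¹ - (U''(q₀) + V''(r₀) + V''(r₋₁))·η + V''(r₀)·η∘τ`
  (`r_n = q_{n+1} - q_n`): the right-hand side of the linearised equation of motion `𝒜(𝒜 η) = L η`
  satisfied by the characteristics of symmetries and by the variational derivatives of conserved
  densities (the operator `f_* ` of the symmetry approach, here for `q̈_n = F_n`).

## Sources

* Yamilov 2006 (J. Phys. A 39, R541), §2.1–2.2: shift operator `T`, formal variational derivative,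
  "`δ/δu_n (T - 1) g = 0`", linearised equation `(D_t - f_*)φ = 0` for symmetries and its adjoint for
  conserved densities; §4 (Toda-type lattices `u_{n,tt} = f(u_{n+1}, u_n, u_{n-1}, u_{n,t})`).
* Bernardin 2014, §1.1 (local functions of the infinite chain; the tree's `boxRestrict`, `partialQZ`,
  `partialPZ`, `liouvilleZ`, `shift`).

## Design notes

* `IsSmoothLocal` is LITERALLY the hypothesis shape `∃ R g, ContDiff ℝ ⊤ g ∧ f = g ∘ boxRestrict R` used by
  the route item, so that results about it apply by `exact`.
* Site-(in)dependence of observables is expressed with Mathlib's `DependsOn f s` (`s : Set ℤ`); nothing new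
  is defined for it.
* The variational derivatives are finite window sums (no `tsum`), the window being an explicit argument;
  the helper files prove window-independence for local `f`.
* For `pinnedChain ω₂ lam β γ` (`U = ω₂q²/2 + lam q⁴/4`, `V = r²/2 + βr⁴/4`) the stiffness is
  `1 + 3β r_n²` and `U'' = ω₂ + 3 lam q²` (`stiff_pinnedChain`, `linForceOp_pinnedChain`).
* NOT here: any calculus (closure properties, Leibniz/chain rules, Schwarz, the variational identities,
  exactness of the variational complex) — those are proved in the `Theorems/LocalOhmBVNoLocalIntegrals*`
  helper files of the route; no proposition about the chain is asserted in this module.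
-/

noncomputable section

open scoped ContDiff
open Set

namespace Literature.MathematicalPhysics.KineticTheory.HeatConduction

/-! ### Smooth local observables -/

/-- A SMOOTH LOCAL observable of the infinite chain: `f = g ∘ boxRestrict R` for some centred box
`{-R, …, R}` and some `g : (ℝ × ℝ)^{2R+1} → ℝ` of class `C^∞` (Bernardin's local `C^∞` functions, no
boundedness required). [cite: Bernardin2014, §1.1] -/
def IsSmoothLocal (f : ChainConfig → ℝ) : Prop :=
  ∃ (R : ℕ) (g : (Fin (2 * R + 1) → ℝ × ℝ) → ℝ), ContDiff ℝ ∞ g ∧ f = g ∘ boxRestrict R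

/-- A smooth local observable depends only on the sites of some centred box. [folklore] -/
theorem IsSmoothLocal.exists_dependsOn {f : ChainConfig → ℝ} (hf : IsSmoothLocal f) :
    ∃ R : ℕ, DependsOn f (Icc (-(R : ℤ)) R) := by
  obtain ⟨R, g, -, rfl⟩ := hf
  refine ⟨R, fun σ σ' h => ?_⟩
  simp only [Function.comp_apply]
  congr 1
  funext i
  simp only [boxRestrict_apply]
  exact h _ ⟨by omega, by omega⟩

/-- A `C^∞` profile on any finite box `{a, …, a+n}` defines a smooth local observable (re-boxing on a
centred box through a coordinate projection). [folklore] -/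
theorem isSmoothLocal_comp_boxRestrictAt (a : ℤ) (n : ℕ) {g : (Fin (n + 1) → ℝ × ℝ) → ℝ}
    (hg : ContDiff ℝ ∞ g) : IsSmoothLocal (g ∘ boxRestrictAt a n) := by
  let R : ℕ := a.natAbs + n
  let idx : Fin (n + 1) → Fin (2 * R + 1) := fun i =>
    ⟨(a + i + R).toNat, by have := i.isLt; omega⟩
  have hidx : ∀ i : Fin (n + 1), ((idx i : ℕ) : ℤ) - R = a + i := by
    intro i
    have := i.isLt
    simp only [idx, R]
    omega
  let π : (Fin (2 * R + 1) → ℝ × ℝ) →L[ℝ] (Fin (n + 1) → ℝ × ℝ) :=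
    ContinuousLinearMap.pi fun i => ContinuousLinearMap.proj (idx i)
  refine ⟨R, g ∘ π, hg.comp π.contDiff, ?_⟩
  funext σ
  simp only [Function.comp_apply]
  congr 1
  funext i
  simp only [boxRestrictAt_apply, π, ContinuousLinearMap.pi_apply, ContinuousLinearMap.proj_apply,
    boxRestrict_apply, hidx]

/-! ### Iterated shift and reflection of the lattice -/

/-- The iterated lattice shift `(τᵏ σ)_x = σ_{x+k}`, `k ∈ ℤ` (`shiftPow 1 = shift`; `shiftPow (-1)` is its
inverse). [cite: Yamilov2006, §2.1] -/
def shiftPow (k : ℤ) (σ : ChainConfig) : ChainConfig := fun x => σ (x + k)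

/-- The lattice reflection `(ρ σ)_x = σ_{-x}` (positions and momenta unchanged; an involution).
[folklore] -/
def reflectZ (σ : ChainConfig) : ChainConfig := fun x => σ (-x)

/-- Unfolding `shiftPow`. [folklore] -/
@[simp] theorem shiftPow_apply (k : ℤ) (σ : ChainConfig) (x : ℤ) : shiftPow k σ x = σ (x + k) := rfl

/-- Unfolding `reflectZ`. [folklore] -/
@[simp] theorem reflectZ_apply (σ : ChainConfig) (x : ℤ) : reflectZ σ x = σ (-x) := rfl

/-- `τ⁰ = id`. [folklore] -/
@[simp] theorem shiftPow_zero (σ : ChainConfig) : shiftPow 0 σ = σ := by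
  funext x; simp

/-- `τ¹` is the shift `shift` of `InfiniteChainInvariantStates`. [folklore] -/
theorem shiftPow_one : shiftPow 1 = shift := rfl

/-- `τʲ (τᵏ σ) = τ^{k+j} σ`. [folklore] -/
theorem shiftPow_shiftPow (j k : ℤ) (σ : ChainConfig) :
    shiftPow j (shiftPow k σ) = shiftPow (k + j) σ := by
  funext x
  simp only [shiftPow_apply]
  congr 1
  ring

/-- The reflection is an involution. [folklore] -/
@[simp] theorem reflectZ_reflectZ (σ : ChainConfig) : reflectZ (reflectZ σ) = σ := by
  funext x; simp

/-! ### Variational derivatives -/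

/-- The POSITION variational derivative of a density `f` over the index window `S`:
`E_q f (σ) = ∑_{n ∈ S} (∂_{q_n} f)(τ⁻ⁿ σ)` (Yamilov's `δ/δu = ∑_i T^{-i} ∂/∂u_i`, position variables).
[cite: Yamilov2006, §2.2] -/
def varDerivQ (S : Finset ℤ) (f : ChainConfig → ℝ) (σ : ChainConfig) : ℝ :=
  ∑ n ∈ S, partialQZ n f (shiftPow (-n) σ)

/-- The MOMENTUM variational derivative of a density `f` over the index window `S`:
`E_p f (σ) = ∑_{n ∈ S} (∂_{p_n} f)(τ⁻ⁿ σ)`. [cite: Yamilov2006, §2.2] -/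
def varDerivP (S : Finset ℤ) (f : ChainConfig → ℝ) (σ : ChainConfig) : ℝ :=
  ∑ n ∈ S, partialPZ n f (shiftPow (-n) σ)

/-! ### Bond stiffness and the linearised force operator -/

namespace OscillatorChain

variable (P : OscillatorChain)

/-- The bond stiffness `a_n(σ) = V''(q_{n+1} - q_n)` of the chain `P` (second derivative of the interaction
along the bond `(n, n+1)`). [folklore] -/
def stiff (σ : ChainConfig) (n : ℤ) : ℝ := deriv (deriv P.V) ((σ (n + 1)).1 - (σ n).1)

/-- The stiffness product `π_M(σ) = ∏_{i=0}^{M-1} V''(q_{i+1} - q_i)` (`π₀ = 1`). [folklore] -/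
def stiffProd (M : ℕ) (σ : ChainConfig) : ℝ := ∏ i ∈ Finset.range M, P.stiff σ i

/-- The LINEARISED FORCE (Jacobi) operator of the chain `P` on a lattice variation `η`:
`(Lη)(σ) = V''(r₋₁) η(τ⁻¹σ) - (U''(q₀) + V''(r₀) + V''(r₋₁)) η(σ) + V''(r₀) η(τσ)`, `r_n = q_{n+1} - q_n`
— the Fréchet derivative `F_*` of the force `F₀ = -U'(q₀) + V'(r₀) - V'(r₋₁)` applied to the variation
`(η∘τⁿ)_n`; the linearised equation of motion reads `𝒜(𝒜 η) = L η`. [cite: Yamilov2006, §2.1] -/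
def linForceOp (η : ChainConfig → ℝ) (σ : ChainConfig) : ℝ :=
  P.stiff σ (-1) * η (shiftPow (-1) σ)
    - (deriv (deriv P.U) (σ 0).1 + P.stiff σ 0 + P.stiff σ (-1)) * η σ
    + P.stiff σ 0 * η (shift σ)

/-- Unfolding `stiffProd`: `π₀ = 1`. [folklore] -/
@[simp] theorem stiffProd_zero (σ : ChainConfig) : P.stiffProd 0 σ = 1 := by
  simp [stiffProd]

/-- Unfolding `stiffProd`: `π_{M+1} = π_M · a_M`. [folklore] -/
theorem stiffProd_succ (M : ℕ) (σ : ChainConfig) :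
    P.stiffProd (M + 1) σ = P.stiffProd M σ * P.stiff σ M := by
  simp [stiffProd, Finset.prod_range_succ]

end OscillatorChain

/-! ### The pinned anharmonic chain: `V'' = 1 + 3βr²`, `U'' = ω₂ + 3 lam q²` -/

/-- `V'(r) = r + β r³` for `pinnedChain`. [folklore] -/
theorem pinnedChain_deriv_V_eq (ω₂ lam β γ : ℝ) :
    deriv (pinnedChain ω₂ lam β γ).V = fun r => r + β * r ^ 3 := by
  have hV : (pinnedChain ω₂ lam β γ).V = fun r => r ^ 2 / 2 + β * r ^ 4 / 4 := rfl
  rw [hV]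
  funext r
  have h : HasDerivAt (fun r : ℝ => r ^ 2 / 2 + β * r ^ 4 / 4)
      (((2 : ℕ) : ℝ) * r ^ (2 - 1) / 2 + β * (((4 : ℕ) : ℝ) * r ^ (4 - 1)) / 4) r :=
    ((hasDerivAt_pow 2 r).div_const 2).add (((hasDerivAt_pow 4 r).const_mul β).div_const 4)
  rw [h.deriv]
  push_cast
  ring

/-- `V''(r) = 1 + 3β r²` for `pinnedChain`. [folklore] -/
theorem pinnedChain_deriv_deriv_V_eq (ω₂ lam β γ : ℝ) :
    deriv (deriv (pinnedChain ω₂ lam β γ).V) = fun r => 1 + 3 * β * r ^ 2 := by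
  rw [pinnedChain_deriv_V_eq]
  funext r
  have h : HasDerivAt (fun r : ℝ => r + β * r ^ 3) (1 + β * (((3 : ℕ) : ℝ) * r ^ (3 - 1))) r :=
    (hasDerivAt_id r).add ((hasDerivAt_pow 3 r).const_mul β)
  rw [h.deriv]
  push_cast
  ring

/-- `U'(q) = ω₂ q + lam q³` for `pinnedChain`. [folklore] -/
theorem pinnedChain_deriv_U_eq (ω₂ lam β γ : ℝ) :
    deriv (pinnedChain ω₂ lam β γ).U = fun q => ω₂ * q + lam * q ^ 3 := by
  have hU : (pinnedChain ω₂ lam β γ).U = fun q => ω₂ * q ^ 2 / 2 + lam * q ^ 4 / 4 := rfl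
  rw [hU]
  funext q
  have h : HasDerivAt (fun q : ℝ => ω₂ * q ^ 2 / 2 + lam * q ^ 4 / 4)
      (ω₂ * (((2 : ℕ) : ℝ) * q ^ (2 - 1)) / 2 + lam * (((4 : ℕ) : ℝ) * q ^ (4 - 1)) / 4) q :=
    (((hasDerivAt_pow 2 q).const_mul ω₂).div_const 2).add
      (((hasDerivAt_pow 4 q).const_mul lam).div_const 4)
  rw [h.deriv]
  push_cast
  ring

/-- `U''(q) = ω₂ + 3 lam q²` for `pinnedChain`. [folklore] -/
theorem pinnedChain_deriv_deriv_U_eq (ω₂ lam β γ : ℝ) :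
    deriv (deriv (pinnedChain ω₂ lam β γ).U) = fun q => ω₂ + 3 * lam * q ^ 2 := by
  rw [pinnedChain_deriv_U_eq]
  funext q
  have h : HasDerivAt (fun q : ℝ => ω₂ * q + lam * q ^ 3)
      (ω₂ * 1 + lam * (((3 : ℕ) : ℝ) * q ^ (3 - 1))) q :=
    ((hasDerivAt_id' q).const_mul ω₂).add ((hasDerivAt_pow 3 q).const_mul lam)
  rw [h.deriv]
  push_cast
  ring

/-- The bond stiffness of `pinnedChain` is `1 + 3β (q_{n+1} - q_n)²`. [folklore] -/
theorem stiff_pinnedChain (ω₂ lam β γ : ℝ) (σ : ChainConfig) (n : ℤ) :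
    (pinnedChain ω₂ lam β γ).stiff σ n = 1 + 3 * β * ((σ (n + 1)).1 - (σ n).1) ^ 2 := by
  simp [OscillatorChain.stiff, pinnedChain_deriv_deriv_V_eq]

/-- The linearised force operator of `pinnedChain`, explicitly. [folklore] -/
theorem linForceOp_pinnedChain (ω₂ lam β γ : ℝ) (η : ChainConfig → ℝ) (σ : ChainConfig) :
    (pinnedChain ω₂ lam β γ).linForceOp η σ =
      (1 + 3 * β * ((σ 0).1 - (σ (-1)).1) ^ 2) * η (shiftPow (-1) σ)
        - (ω₂ + 3 * lam * (σ 0).1 ^ 2 + (1 + 3 * β * ((σ 1).1 - (σ 0).1) ^ 2)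
            + (1 + 3 * β * ((σ 0).1 - (σ (-1)).1) ^ 2)) * η σ
        + (1 + 3 * β * ((σ 1).1 - (σ 0).1) ^ 2) * η (shift σ) := by
  simp only [OscillatorChain.linForceOp, stiff_pinnedChain, pinnedChain_deriv_deriv_U_eq]
  norm_num

/-- The bond stiffness of `pinnedChain` is at least `1` for `β ≥ 0`. [folklore] -/
theorem one_le_stiff_pinnedChain (ω₂ lam γ : ℝ) {β : ℝ} (hβ : 0 ≤ β) (σ : ChainConfig) (n : ℤ) :
    1 ≤ (pinnedChain ω₂ lam β γ).stiff σ n := by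
  rw [stiff_pinnedChain]
  nlinarith [sq_nonneg ((σ (n + 1)).1 - (σ n).1)]

/-- The bond stiffness of `pinnedChain` is positive for `β ≥ 0`. [folklore] -/
theorem stiff_pinnedChain_pos (ω₂ lam γ : ℝ) {β : ℝ} (hβ : 0 ≤ β) (σ : ChainConfig) (n : ℤ) :
    0 < (pinnedChain ω₂ lam β γ).stiff σ n :=
  lt_of_lt_of_le one_pos (one_le_stiff_pinnedChain ω₂ lam γ hβ σ n)

/-- The stiffness product of `pinnedChain` is positive for `β ≥ 0`. [folklore] -/
theorem stiffProd_pinnedChain_pos (ω₂ lam γ : ℝ) {β : ℝ} (hβ : 0 ≤ β) (M : ℕ) (σ : ChainConfig) :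
    0 < (pinnedChain ω₂ lam β γ).stiffProd M σ :=
  Finset.prod_pos fun i _ => stiff_pinnedChain_pos ω₂ lam γ hβ σ i

end Literature.MathematicalPhysics.KineticTheory.HeatConduction
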